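import Literature.NumberTheory.EllipticCurves.HeegnerModuleIndex
import HarnessLib

/-!
# The twisted Heegner family and its Heegner module: Heegner points of `p`-power conductor of a
# `ℚ`-form `E′` of `E`, transported to `E` along a `K̄`-isomorphism (the weight-2 "Heegner pair"
# `(f_{E′}, χ)` of Castella–Hsieh 2018 / Keller–Yin 2024b, Case (I)) — DEFINITIONS only

Cross-ladder LITERATURE-TYPING layer (D-0088(4)), cell `bsd-littype`, seat `bsd-littype-06` (gen 3).
PURPOSE: the one missing NOTION behind the typed GAP "Keller–Yin arXiv:2410.23241 Conj. 3.3.1 /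
Thm. 3.3.6 / the Heegner-point form of Thm. 3.5.1" recorded on the cell's sheets (HANDOFF § 06,
OPEN-QUESTIONS-06 §C-1 (ii)): the `Λ`-adic line `Λκ₁ ⊆ H¹_{𝓕_{Λ,ε}}(K, 𝐓_ε)` "coming from a Heegner
point associated to the Heegner pair `(f̃, χ_ε)` as in [JLZ21]" (Conj. 3.3.1 (ii), p0017), whose index
carries Perrin-Riou's Heegner point main conjecture for an elliptic curve `E/ℚ` with ADDITIVE,
potentially good ordinary reduction at `p`. This file DEFINES that vocabulary and asserts NOTHING
(no named fact, no claim). Sibling of `HeegnerModuleIndex.lean` (Howard's `𝐇 = lim← H_k` for the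
classical Heegner points of `E` itself at a prime `p ∤ N`) and of
`Castella2024/LambdaAdicHeegnerClass.lean` (regularised classes at `p ∣ N`).

## The sources, verbatim, and the dictionary they print

* **Keller–Yin 2024b** (arXiv:2410.23241v1, UNREFEREED; store `paper:arxiv-2410.23241`, chunk:line).
  §3.1 (p0013 L35–p0014 L8): the newform `f` of `E` is `f = f̃ ⊗ ε` with `f̃ ∈ S₂(Γ₀(N′), ε⁻²)`
  `p`-ordinary, "Case I: … `f̃` has good reduction", and `χ_ε := ε ∘ Nm_{K/ℚ}` (Prop. 3.1.3,
  p0014 L33; `V(f̃) ⊗ χ_ε|_{G_K} = V(f)|_{G_K}`, Prop. 3.1.3 (ii)); §3.6 (p0020 L44): "when `E` is an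
  elliptic curve, we have `T_ε = T_pE`"; Conj. 3.3.1 (p0017 L43–L48): "`κ₁` is a class coming from a
  Heegner point associated to the Heegner pair `(f̃, χ_ε)` as in [JLZ21]"; proof of Thm. 3.3.5 (p0018
  L14): "we simply consider cycles `Δ_{np^m}` coming from pairs `(A_{𝒪_{np^m}}, φ_{𝒪_{np^m}})` and
  consider their images `z_{ét,np^m}^{[f̃,0]} ∈ H¹(K[np^m], T̃_ε)` … **These images are nothing but the
  `z_{f,𝒪_{np^m}}` in [CastellaHsieh] where their `χ` is our `χ_ε`**"; (p0019 L55): "`κ₁^{Hg}`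
  projects to `cores_{K_1/K} z_{ét,1}^{[f̃,0]}`".
* **Castella–Hsieh 2018** (Math. Ann. 370, REFEREED; store `paper:arxiv-1505.08165`, chunk:line), for
  a newform `f` of level `N` with `p ∤ 2(2r−1)!Nφ(N)` (§4.2, p0012 L53): the CM points
  `x_𝔞 = [(A_𝔞, A_𝔞[𝔑])] ∈ X₀(N)` of conductor `c` (§4.1, p0012 L37; `N𝒪_K = 𝔑𝔑̄`), the classes
  `z_{f,𝔞} := Φ_{ét,f}(Δ_{φ_𝔞}) ∈ H¹(K[c], T ⊗ S^{r₁}(A))`, `r₁ = r − 1` (§4.2, p0012 L69–L71; weight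
  `2`: `r₁ = 0`, the Abel–Jacobi = Kummer image of the CM point), and for an anticyclotomic character
  `χ` of conductor `c_o p^s` the `χ`-components "`z_{f,χ,c} := (id ⊗ e_χ)(z_{f,c} ⊗ χ_t) ∈
  H¹(K[c], T ⊗ χ)`" (§4.4, p0014 L57–L60), "obtained by taking the `χ`-component of the `p`-adic
  Abel–Jacobi image of generalized Heegner cycles … `z_{f,χ} := cores_{K[c]/K}(z_{f,χ,c})`" (§1,
  p0004 L4–L8); the anticyclotomic variable is the `p`-power part of the conductor `c`.
* READ AT CASE (I) FOR AN ELLIPTIC CURVE (`e = 2`, the scope of the printed proof; OPEN-QUESTIONS-06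
  Q-B1/§C-1): `ε = (·/p)`, `f̃ = f_{E′}` the newform of a `ℚ`-form `E′` of `E` (the quadratic twist
  `E^{(p*)}`, conductor `N′`, GOOD ordinary at `p`), `χ_ε` the quadratic character of
  `K(√p*) ⊂ K[p]`, and `E ≅ E′` over `ℚ(√p*)`. Hence, for `p ∣ c`, the isomorphism `θ : E′ → E` is
  defined over the ring class field `K[c]`, the Heegner point `P′[c] ∈ E′(K[c])` of `E′` (CM point of
  conductor `c` on `X₀(N′)`, `gcd(c, N′) = 1`) gives `θ(P′[c]) ∈ E(K[c])`, and for `σ ∈ Gal(K[c]/K_n)`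
  one has `∑_σ σ·θ(P′[c]) = θ(∑_σ χ_ε(σ) σ·P′[c])`: **the plain norm to `K_n` of the transported point
  `θ(P′[p^{n+1}])` IS the `χ_ε`-component of the Heegner point of `E′`**, i.e. (with `T_pE = T_pE′ ⊗ χ_ε`)
  the bottom layer of Castella–Hsieh's `z_{f̃,χ_ε,·}` = Keller–Yin's `κ₁` read in `H¹(K_n, T_pE)`.
  This file types exactly that: points of `E(K̄)` obtained from the tree's Heegner points of `E′`
  (`IsHeegnerGeomPoint N′ W′ K Dt′ β c jbar`, file `HeegnerModuleIndex.lean`) by a `K̄`-isomorphism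
  `E′_{K̄} ≅ E_{K̄}` (`GeomTransport`: an admissible change of variables over `K̄`, Silverman III.3.1(b)),
  their norms to the anticyclotomic layers `K_n` (`IsTwistedHeegnerNormPoint`), families of such norm
  points of conductors `p^{j+1}` (`TwistedHeegnerFamily`), and — verbatim the construction of
  `heegnerModule` — the `Λ`-module `ℋ^θ_∞ ⊆ 𝔖_p(E/K_∞)` they generate (`twistedHeegnerModule D F`) with
  its characteristic ideal `twistedHeegnerCharIdeal D F = char_Λ(𝔖/ℋ^θ_∞)` and index.

## Design notes (what is and is not pinned)

* The transport is DATA (`F.T : GeomTransport W′ W K`): a change of variables `C` over `K̄` with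
  `C • E′_{K̄} = E_{K̄}` on the nose, acting on geometric points by the tree's
  `VariableChange.pointEquiv` (`GeomTransport.equiv`). For `j(E) ∉ {0, 1728}` two such `C` differ by
  `[±1]` (Silverman III.10.1), so the MODULE generated does not depend on the choice; the predicate
  `IsTwistedHeegnerNormPoint` moreover REQUIRES the transported point to be fixed by `Gal(K̄/K[c])`
  (as `IsHeegnerNormPoint` does), which for the quadratic twist `E′ = E^{(p*)}` and `p ∣ c` is the
  genus-theory inclusion `K(√p*) ⊆ K[p] ⊆ K[c]` (genus theory for the order of conductor `p`; cf. Cox, Thm. 6.1 with §7.D–§9.A) — not proved here: NON-VACUITY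
  (`Nonempty (TwistedHeegnerFamily …)`) is NOT asserted in this file; its inputs are the tree fact
  `exists_isHeegnerNormPoint N′ W′ K p` (Heegner points of `E′`, `p ∤ N′`), Silverman X.5.4 (the twist
  isomorphism over `ℚ(√p*)`, tree `twistUntwist_smul_baseChange`) and that inclusion.
* No conductor-`1` generator: `χ_ε` has conductor `p`, the family starts at `P′[p]`
  (`F.z 0 = Norm_{K[p]/K} θ(P′[p]) ∈ E(K)`, `TwistedHeegnerFamily.exists_toGeomPoints_eq_z_zero` — the
  `K`-rational "Heegner point of the pair" whose non-torsionness drives Keller–Yin Thm. 3.3.5 and,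
  through a Gross–Zagier formula WITH ring class character, Thm. 3.7.1; OPEN-QUESTIONS-06 Q-B5).
* `Λκ₁` vs `ℋ^θ_∞`: as in the siblings (`heegnerModule` = Howard's `𝐇 = Λκ₁^{Hg}` by Howard 2004 Thm.
  3.3.7 under `p ∤ h_K`), consumers read Keller–Yin's `Λκ₁ = Λκ_∞` as `twistedHeegnerModule D F`; the
  twisted analogue of Howard's Thm. 3.3.7 (`ℋ^θ_∞` free of rank one, generated by the regularised
  bottom class) is asserted by Keller–Yin only as "(H.3) follows from an analog of [How2004]. One just
  need to take an extra twist by `ε` of everything" (p0017 L61) — a flag on every consumer, not a fact.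
* Mathlib/tree search (`lean search`): `twisted.*Heegner`, `chi.*isotypic`, `HeegnerPair`,
  `geomPointsEquiv` (tree `BSDInvariantsProofs.geomPointsEquiv` is the `K`-rational case `C` over `K`),
  `CMTwistCocycleProofs.exists_addEquiv_geomPoints_cocycle_of_j_eq` (existence of such `K̄`-isomorphisms
  for `j(E) = j(E′)`; not needed for the definitions) — nothing to reuse beyond what is imported.

## References

* [CastellaHsieh2018] F. Castella, M.-L. Hsieh, *Heegner cycles and `p`-adic `L`-functions*, Math.
  Ann. 370 (2018), 567–628: §4.1–§4.5 (Heegner point Euler systems `z_{f,c}`, `z_{f,χ,c}`), Def. 3.5.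
* Keller–Yin, arXiv:2410.23241v1 (2024): §3.1, Prop. 3.1.3, Rem. 3.2.2, Conj. 3.3.1, proof of Thm.
  3.3.5, §3.4 before Prop. 3.4.4 (locators above) — UNREFEREED; only its NOTATION is transcribed here.
* [Howard2004HeegnerKolyvagin] §3.3 (`H_k`, `𝐇 = lim← H_k`, the Kummer maps `δ_k`), Thm. 3.3.7.
* [PerrinRiou1987BSMF] §3.4 (`ℋ_n`, `ℋ_∞`), §1 p. 405 (`I(ℋ_∞)`).
* [SilvermanAEC2009] III.3.1(b) (isomorphisms are changes of variables), X.5.4 (quadratic twists).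
* [Cox2013] D. A. Cox, *Primes of the form x² + ny²*, Thm. 6.1 (genus theory), Thm. 11.1.
* Cell documents: `run/shared/lean/pub/bsd-littype/OPEN-QUESTIONS-06.md` §C-1, `…/staging/bsd-littype-06/`.
-/

set_option autoImplicit false

noncomputable section

open scoped Classical

open NumberField IsDedekindDomain

universe u

namespace Literature.NumberTheory.EllipticCurves

open WeierstrassCurve ModularForms

/-! ## Part 1. `K̄`-isomorphisms `E′_{K̄} ≅ E_{K̄}` as changes of variables, acting on `E′(K̄)` -/

section Transport

variable (W' W : WeierstrassCurve ℚ) (K : Type u) [Field K] [NumberField K]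

/-- **A `K̄`-isomorphism `E′_{K̄} ≅ E_{K̄}` of two curves over `ℚ`, base-changed to a number field
`K`**, given as an admissible change of variables `C = (u, r, s, t)` over `K̄` with `C • E′ = E` on the
nose (every isomorphism of elliptic curves is of this form, Silverman III.3.1(b); such `C` exist iff
`j(E′) = j(E)`, III.1.4(b)). The case of interest: `E′ = E^{(d)}` a quadratic twist, `C` the twisting
substitution `u = √d` composed with `ℚ`-rational substitutions (X.5.4; tree
`twistUntwist_smul_baseChange`). Data only; nothing asserted. [cite: SilvermanAEC2009, III.3.1(b) and X.5.4] -/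
structure GeomTransport where
  /-- The change of variables over `K̄`. -/
  C : VariableChange (AlgebraicClosure K)
  /-- `C • E′_{K̄} = E_{K̄}`. -/
  smul_eq : C • (W'.baseChange K).baseChange (AlgebraicClosure K) =
    (W.baseChange K).baseChange (AlgebraicClosure K)

namespace GeomTransport

variable {W' W K} (T : GeomTransport W' W K)

/-- The induced isomorphism of geometric point groups `θ_C : E′(K̄) ≃+ E(K̄)`,
`(x, y) ↦ (u⁻²(x − r), u⁻³(y − s(x − r) − t))` (tree `VariableChange.pointEquiv` followed by the
transport along `C • E′_{K̄} = E_{K̄}`). [cite: SilvermanAEC2009, III.3.1(b)] -/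
def equiv : geomPoints (W'.baseChange K) ≃+ geomPoints (W.baseChange K) :=
  (VariableChange.pointEquiv ((W'.baseChange K).baseChange (AlgebraicClosure K)) T.C).trans
    (Affine.Point.congrEquiv T.smul_eq)

end GeomTransport

end Transport

/-! ## Part 2. Norms over a transversal are rational over the layer (pure group theory) -/

section Transversal

variable {Γ : Type*} [Group Γ] {M : Type*} [AddCommMonoid M] [DistribMulAction Γ M]

/-- **A norm over a transversal is fixed by the big group.** If `x` is fixed by a subgroup `G`,
`R ⊆ H` meets every coset `τG`, `τ ∈ H`, exactly once, then `τ • ∑_{r ∈ R} r • x = ∑_{r ∈ R} r • x`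
for every `τ ∈ H` (`τ` permutes the cosets). The group theory behind "`Norm_{K[c]/K_n} P ∈ E(K_n)`"
(Howard 2004, §3.3: "`Norm_{K_k[1]/K_k} P_k[1] ∈ E(K_k)`"), extracted from the tree's
`IsHeegnerNormPoint.smul_eq_self`. [cite: Howard2004HeegnerKolyvagin, §3.3 (Norm_{K_k[1]/K_k} P_k[1] ∈ E(K_k))] -/
theorem smul_sum_smul_eq_of_transversal {G H : Subgroup Γ} {x : M} {R : Finset Γ}
    (hfix : ∀ σ ∈ G, σ • x = x) (hRsub : ↑R ⊆ (H : Set Γ))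
    (htrans : ∀ τ ∈ H, ∃! r, r ∈ R ∧ r⁻¹ * τ ∈ G) {τ : Γ} (hτ : τ ∈ H) :
    τ • ∑ r ∈ R, r • x = ∑ r ∈ R, r • x := by
  have key : ∀ r ∈ R, ∃! r', r' ∈ R ∧ r'⁻¹ * (τ * r) ∈ G := fun r hr ↦
    htrans (τ * r) (H.mul_mem hτ (hRsub hr))
  choose! f hf using fun r (hr : r ∈ R) ↦ (key r hr).exists
  have hval : ∀ r ∈ R, (τ * r) • x = f r • x := fun r hr ↦ by
    have h1 : (f r)⁻¹ * (τ * r) ∈ G := (hf r hr).2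
    calc (τ * r) • x = (f r * ((f r)⁻¹ * (τ * r))) • x := by rw [mul_inv_cancel_left]
      _ = f r • ((f r)⁻¹ * (τ * r)) • x := mul_smul _ _ _
      _ = f r • x := by rw [hfix _ h1]
  have hinj : Set.InjOn f ↑R := by
    intro r₁ hr₁ r₂ hr₂ heq
    have h1 : (f r₁)⁻¹ * (τ * r₁) ∈ G := (hf r₁ hr₁).2
    have h2 : (f r₂)⁻¹ * (τ * r₂) ∈ G := (hf r₂ hr₂).2
    rw [heq] at h1
    have h12 : r₁⁻¹ * r₂ ∈ G := by
      have := G.mul_mem (G.inv_mem h1) h2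
      rwa [show ((f r₂)⁻¹ * (τ * r₁))⁻¹ * ((f r₂)⁻¹ * (τ * r₂)) = r₁⁻¹ * r₂ by group] at this
    have hu := htrans r₂ (hRsub hr₂)
    exact hu.unique ⟨hr₁, h12⟩ ⟨hr₂, by rw [inv_mul_cancel]; exact G.one_mem⟩
  have hmaps : Set.MapsTo f ↑R ↑R := fun r hr ↦ (hf r hr).1
  have hsurj : Set.SurjOn f ↑R ↑R := Finset.surjOn_of_injOn_of_card_le f hmaps hinj le_rfl
  rw [Finset.smul_sum]
  simp_rw [← mul_smul]
  exact Finset.sum_nbij f hmaps hinj hsurj hval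

end Transversal

/-! ## Part 3. Transported Heegner points of conductor `c` and their norms to the layers `K_n` -/

section HeegnerGeom

variable (N' : ℕ) [NeZero N'] (W W' : WeierstrassCurve ℚ) (K : Type u) [Field K] [NumberField K]
  {p : ℕ} [Fact p.Prime]

/-- **Norm to the layer `K_n` of a transported Heegner point of conductor `c`.** `z ∈ E(K̄)` is
`∑_{σ ∈ Gal(K[c]/K_n)} σ · θ_C(P′[c])` where `P′[c] = x′ ∈ E′(K̄)` is a Heegner point of `E′` of
level `N′`, conductor `c` and orientation `β` for the parametrisation datum `Dt′` of `E′` (the tree's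
`IsHeegnerGeomPoint N′ W′ K Dt′ β c jbar x′`: `complexPoint x′ = φ′(τ_Q)`), `K[c]`-rational
(fixed by `ringClassSubgroup K c jbar = Gal(K̄/K[c])`), whose transport `θ_C x′ ∈ E(K̄)` along the
`K̄`-isomorphism `T` is ALSO `K[c]`-rational, the sum taken over a transversal `R ⊆ Gal(K̄/K_n)` of
`Gal(K̄/K[c])` — word for word the tree's `IsHeegnerNormPoint` with `x = θ_C x′`. For the quadratic
twist `E′ = E^{(p*)}` and `p ∣ c` this is `θ_C` of the `χ_ε`-twisted norm `∑_σ χ_ε(σ) σ·P′[c]`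
(module docstring): the bottom layer of Castella–Hsieh's `z_{f̃,χ_ε,·}` / Keller–Yin's `κ₁`.
[cite: CastellaHsieh2018, §4.4 (the χ-component of the Heegner classes z_{f,c})] [cite: Howard2004HeegnerKolyvagin, §3.3 (norms Norm_{K[p^{k+1}]/K_k})] -/
def IsTwistedHeegnerNormPoint (κ : ZpExtension K p) (Dt' : ModularParametrizationData W' N') (β : ℤ)
    (T : GeomTransport W' W K) (jbar : AlgebraicClosure K →+* ℂ) (n c : ℕ)
    (z : geomPoints (W.baseChange K)) : Prop :=
  ∃ (x' : geomPoints (W'.baseChange K)) (R : Finset (Field.absoluteGaloisGroup K)),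
    IsHeegnerGeomPoint N' W' K Dt' β c jbar x' ∧
    (∀ σ ∈ ringClassSubgroup K c jbar, σ • x' = x') ∧
    (∀ σ ∈ ringClassSubgroup K c jbar, σ • T.equiv x' = T.equiv x') ∧
    (↑R ⊆ (κ.layerSubgroup n : Set (Field.absoluteGaloisGroup K))) ∧
    (∀ τ ∈ κ.layerSubgroup n, ∃! r, r ∈ R ∧ r⁻¹ * τ ∈ ringClassSubgroup K c jbar) ∧
    z = ∑ r ∈ R, r • T.equiv x'

variable {N' W W' K}

/-- **A transported norm to `K_n` is `K_n`-rational**: `τ • z = z` for every `τ ∈ Gal(K̄/K_n)`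
(`smul_sum_smul_eq_of_transversal`; no CM input); Howard 2004, §3.3 ("`Norm_{K_k[1]/K_k} P_k[1] ∈ E(K_k)`").
[cite: Howard2004HeegnerKolyvagin, §3.3 (Norm_{K_k[1]/K_k} P_k[1] ∈ E(K_k))] -/
theorem IsTwistedHeegnerNormPoint.smul_eq_self {κ : ZpExtension K p}
    {Dt' : ModularParametrizationData W' N'} {β : ℤ} {T : GeomTransport W' W K}
    {jbar : AlgebraicClosure K →+* ℂ} {n c : ℕ} {z : geomPoints (W.baseChange K)}
    (h : IsTwistedHeegnerNormPoint N' W W' K κ Dt' β T jbar n c z)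
    {τ : Field.absoluteGaloisGroup K} (hτ : τ ∈ κ.layerSubgroup n) : τ • z = z := by
  obtain ⟨x', R, -, -, hfix, hRsub, htrans, rfl⟩ := h
  exact smul_sum_smul_eq_of_transversal hfix hRsub htrans hτ

variable (N' W W' K)

/-- **A twisted Heegner family along the anticyclotomic tower** (data + hypotheses; the analogue of
the tree's `HeegnerFamily` for a Heegner PAIR): a parametrisation datum `Dt′` of the auxiliary curve
`E′ = W′` at level `N′` (`φ′ : X₀(N′) → E′`, newform `f̃ = Dt′.f`), an orientation `β`
(`β² ≡ d_K (mod 4N′)`), a `K̄`-isomorphism `T : E′_{K̄} ≅ E_{K̄}`, and the norm points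
`z j = Norm_{K[p^{j+1}]/K_j} θ_C(P′[p^{j+1}]) ∈ E(K_j)` of conductors `p^{j+1}`, `j ≥ 0`
(`IsTwistedHeegnerNormPoint`); no conductor-`1` generator (the character of the pair has conductor
`p`). These generate the finite-level modules `ℋ^θ_k ⊆ E(K_k) ⊗ ℤ_p` below. Existence is NOT asserted
(module docstring, Design notes). [cite: CastellaHsieh2018, §4.1–§4.4 (Heegner point Euler system of (f, χ))] [cite: Howard2004HeegnerKolyvagin, §3.3 (before Thm. 3.3.7)] -/
structure TwistedHeegnerFamily (κ : ZpExtension K p) (jbar : AlgebraicClosure K →+* ℂ) where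
  /-- The modular parametrisation datum of the auxiliary curve `E′` at level `N′`. -/
  Dt : ModularParametrizationData W' N'
  /-- The orientation: a residue `β` with `β² ≡ d_K (mod 4N′)`. -/
  β : ℤ
  /-- `β² ≡ d_K (mod 4N′)`. -/
  dvd_sq_sub : (4 * N' : ℤ) ∣ β ^ 2 - NumberField.discr K
  /-- The `K̄`-isomorphism `E′_{K̄} ≅ E_{K̄}` transporting the points. -/
  T : GeomTransport W' W K
  /-- The norm points `z_j ∈ E(K_j)` of conductor `p^{j+1}`. -/
  z : ℕ → geomPoints (W.baseChange K)
  /-- `z j = Norm_{K[p^{j+1}]/K_j} θ_C(P′[p^{j+1}])`. -/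
  isTwistedHeegnerNormPoint_z :
    ∀ j, IsTwistedHeegnerNormPoint N' W W' K κ Dt β T jbar j (p ^ (j + 1)) (z j)

namespace TwistedHeegnerFamily

variable {N' W W' K} {κ : ZpExtension K p} {jbar : AlgebraicClosure K →+* ℂ}
  (F : TwistedHeegnerFamily N' W W' K κ jbar)

/-- The generators of the family visible at layer `k`: `z_j` for `j ≤ k`.
[cite: Howard2004HeegnerKolyvagin, §3.3 (before Thm. 3.3.7)] -/
def generators (k : ℕ) : Set (geomPoints (W.baseChange K)) :=
  F.z '' {j | j ≤ k}

/-- `z_j` is a generator at every layer `k ≥ j` (Howard 2004, §3.3: `H_k` is generated by the norm points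
`P_j`, `0 ≤ j ≤ k`). [cite: Howard2004HeegnerKolyvagin, §3.3 (before Thm. 3.3.7)] -/
theorem z_mem_generators {j k : ℕ} (h : j ≤ k) : F.z j ∈ F.generators k :=
  ⟨j, h, rfl⟩

/-- The generators grow with the layer (`H_k ⊆ H_{k+1}` on generators; Howard 2004, §3.3).
[cite: Howard2004HeegnerKolyvagin, §3.3 (before Thm. 3.3.7)] -/
theorem generators_mono {k k' : ℕ} (h : k ≤ k') : F.generators k ⊆ F.generators k' := by
  rintro _ ⟨j, hj, rfl⟩
  exact ⟨j, le_trans hj h, rfl⟩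

/-- `z_j` is `K_k`-rational for `k ≥ j`: fixed by `Gal(K̄/K_k) ≤ Gal(K̄/K_j)`; Howard 2004, §3.3
(`H_k ⊆ E(K_k) ⊗ ℤ_p`). [cite: Howard2004HeegnerKolyvagin, §3.3 (before Thm. 3.3.7)] -/
theorem smul_z_eq_self {j k : ℕ} (h : j ≤ k) {σ : Field.absoluteGaloisGroup K}
    (hσ : σ ∈ κ.layerSubgroup k) : σ • F.z j = F.z j :=
  (F.isTwistedHeegnerNormPoint_z j).smul_eq_self (κ.layerSubgroup_antitone h hσ)

/-- All generators visible at layer `k` are fixed by `Gal(K̄/K_k)` (each is `K_j`-rational for some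
`j ≤ k`); Howard 2004, §3.3 (`H_k ⊆ E(K_k) ⊗ ℤ_p`). [cite: Howard2004HeegnerKolyvagin, §3.3 (before Thm. 3.3.7)] -/
theorem forall_smul_eq_of_mem_generators (k : ℕ) :
    ∀ w ∈ F.generators k, ∀ σ ∈ κ.layerSubgroup k, σ • w = w := by
  rintro _ ⟨j, hj, rfl⟩ σ hσ
  exact F.smul_z_eq_self hj hσ

/-- **The bottom point `z_0 = Norm_{K[p]/K} θ_C(P′[p])` is `K`-rational**: fixed by `Γ_K = Gal(K̄/K_0)`,
hence comes from `E(K)` by Galois descent (`exists_toGeomPoints_eq_of_forall_smul_eq`) — the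
"Heegner point associated to the Heegner pair" whose image in `E(K) ⊗ ℤ_p` is the bottom class of
Keller–Yin's `κ₁` (p0017 L48, p0019 L55). [cite: CastellaHsieh2018, §4.4 (z_{f,χ} over K)] -/
theorem exists_toGeomPoints_eq_z_zero :
    ∃ P : (W.baseChange K).toAffine.Point, toGeomPoints (W.baseChange K) P = F.z 0 :=
  exists_toGeomPoints_eq_of_forall_smul_eq _ fun σ ↦
    (F.isTwistedHeegnerNormPoint_z 0).smul_eq_self (by rw [ZpExtension.layerSubgroup_zero]; trivial)

end TwistedHeegnerFamily

end HeegnerGeom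

/-! ## Part 4. The twisted Heegner module `ℋ^θ_∞ ⊆ 𝔖_p(K_∞)`, its characteristic ideal, its index -/

section TwistedHeegnerModule

variable {K : Type u} [Field K] [NumberField K] {N' : ℕ} [NeZero N'] {W W' : WeierstrassCurve ℚ}
  {p : ℕ} [Fact p.Prime] {κ : ZpExtension K p} {γ : Field.absoluteGaloisGroup K}
  {jbar : AlgebraicClosure K →+* ℂ}

/-- **The finite-level twisted Heegner module `ℋ̄^θ_k ⊆ S_p(E/K_k)`** (inside
`∏_m H¹(Gal(K̄/K_k), E[p^m])`): the additive subgroup generated by the elements `c · conj_{γ^i} δ(w)`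
for `c ∈ ℤ_p`, `i ∈ ℕ` and `w` a generator visible at layer `k` (`z_j`, `j ≤ k`), where
`δ(w) = (δ_{K_k}(w) ∈ H¹(K_k, E[p^m]))_m` is the family of Kummer classes of `w` — VERBATIM the tree's
`heegnerModuleLayer` (Howard's `H_k = ℤ_p[Gal(K_k/K)] · {generators}` under the injective Kummer map)
for the twisted family. [cite: Howard2004HeegnerKolyvagin, §3.3 (H_k, before Thm. 3.3.7)] [cite: CastellaHsieh2018, §4.4] -/
def twistedHeegnerModuleLayer (γ : Field.absoluteGaloisGroup K) (F : TwistedHeegnerFamily N' W W' K κ jbar)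
    (k : ℕ) :
    AddSubgroup (Π m : ℕ, (W.baseChange K).torsionH1Over ((p : ℤ) ^ m) (κ.layerSubgroup k)) :=
  AddSubgroup.closure {v | ∃ (c : ℤ_[p]) (i : ℕ) (w : geomPoints (W.baseChange K))
    (hw : w ∈ F.generators k)
    (d : Π m : ℕ, (W.baseChange K).torsionH1Over ((p : ℤ) ^ m) (κ.layerSubgroup k)),
    (∀ (m : ℕ) (Q : geomPoints (W.baseChange K)) (hQ : ((p : ℤ) ^ m) • Q = w),
      d m = (W.baseChange K).kummerClassOver (κ.layerSubgroup k) ((p : ℤ) ^ m) Q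
        (fun σ hσ ↦ by rw [hQ]; exact F.forall_smul_eq_of_mem_generators k w hw σ hσ)) ∧
    v = (W.baseChange K).padicPi p (κ.layerSubgroup k) c
      ((W.baseChange K).conjPi p (κ.layerSubgroup k) (γ ^ i) d)}

variable (D : (W.baseChange K).LambdaAdicSelmerData κ γ) (F : TwistedHeegnerFamily N' W W' K κ jbar)

/-- **The twisted Heegner module `ℋ^θ_∞ = lim←_k ℋ^θ_k ⊆ 𝔖_p(K_∞)`**: the `Λ`-span of the elements of
`S` all of whose level-`k` projections lie in `ℋ̄^θ_k` (`twistedHeegnerModuleLayer`) — VERBATIM the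
tree's `heegnerModule` for the twisted family; Keller–Yin's `Λκ₁ = Λκ_∞ ⊆ H¹_{𝓕_{Λ,ε}}(K, 𝐓_ε)`
(Conj. 3.3.1 (ii), Thm. 3.5.1) is read as this module (module docstring, "`Λκ₁` vs `ℋ^θ_∞`").
[cite: PerrinRiou1987BSMF, §3.4 and §1 p. 405] [cite: Howard2004HeegnerKolyvagin, §3.3 (𝐇 = lim H_k)] -/
def twistedHeegnerModule : Submodule (IwasawaAlgebra p) D.S :=
  Submodule.span (IwasawaAlgebra p) {s | ∀ k, D.proj k s ∈ twistedHeegnerModuleLayer γ F k}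

/-- **`I(ℋ^θ_∞)`**: the characteristic ideal of the `Λ`-module `𝔖_p(K_∞)/ℋ^θ_∞` (Perrin-Riou's
`I(H_∞)`, Howard's `𝐋 = char(H¹_{F_Λ}(K, 𝐓)/𝐇)`, for the twisted family), through the tree's
`Module.charIdeal`; Keller–Yin's `Char_Λ(H¹_{𝓕_{Λ,ε}}(K, 𝐓_ε)/Λκ₁)` (Conj. 3.3.1 (ii)).
[cite: PerrinRiou1987BSMF, §1 p. 405] [cite: Howard2004HeegnerKolyvagin, §1 eq. (2)] -/
def twistedHeegnerCharIdeal : Ideal (IwasawaAlgebra p) :=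
  Module.charIdeal (IwasawaAlgebra p) (D.S ⧸ twistedHeegnerModule D F)

/-- **The twisted Heegner module index `ord_J I(ℋ^θ_∞) ∈ ℕ∞`**: the multiplicity of the augmentation
prime `J = (γ − 1) = (T)` in `I(ℋ^θ_∞)`, i.e. the length of `(S/ℋ^θ_∞)_{(T)}` (`Module.lengthAt`), the
twisted analogue of the tree's `heegnerModuleIndex` (Howard 2004, §1 eq. (2): the exponent bounding
`corank Sel_{p^∞}(E/K) ≤ 1 + 2·ord_J`). [cite: Howard2004HeegnerKolyvagin, §1 eq. (2)] -/
def twistedHeegnerModuleIndex : ℕ∞ :=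
  Module.lengthAt (IwasawaAlgebra p) (D.S ⧸ twistedHeegnerModule D F)
    ⟨Ideal.span {(PowerSeries.X : IwasawaAlgebra p)}, PowerSeries.span_X_isPrime⟩

/-- Unfolding of `twistedHeegnerCharIdeal` (Perrin-Riou's `I(ℋ_∞)`, §1 p. 405). [cite: PerrinRiou1987BSMF, §1 p. 405] -/
theorem twistedHeegnerCharIdeal_def : twistedHeegnerCharIdeal D F =
    Module.charIdeal (IwasawaAlgebra p) (D.S ⧸ twistedHeegnerModule D F) :=
  rfl

/-- Unfolding of `twistedHeegnerModuleIndex` (Howard's `ord_J 𝐋`, §1 eq. (2)). [cite: Howard2004HeegnerKolyvagin, §1 eq. (2)] -/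
theorem twistedHeegnerModuleIndex_def : twistedHeegnerModuleIndex D F =
    Module.lengthAt (IwasawaAlgebra p) (D.S ⧸ twistedHeegnerModule D F)
      ⟨Ideal.span {(PowerSeries.X : IwasawaAlgebra p)}, PowerSeries.span_X_isPrime⟩ :=
  rfl

/-- An element of `S` all of whose projections lie in the finite-level twisted Heegner modules belongs
to `ℋ^θ_∞` (the generators of the span; Perrin-Riou 1987, §3.4: "`ℋ_∞` la limite projective des `ℋ_n`").
[cite: PerrinRiou1987BSMF, §3.4 (ℋ_∞ = lim ℋ_n)] -/
theorem mem_twistedHeegnerModule_of_proj_mem {s : D.S}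
    (hs : ∀ k, D.proj k s ∈ twistedHeegnerModuleLayer γ F k) : s ∈ twistedHeegnerModule D F :=
  Submodule.subset_span hs

end TwistedHeegnerModule

end Literature.NumberTheory.EllipticCurves

end
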